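import Summits.FinalStateConjecture.FinalStateConjecture.Theorems.PhotonSphereChannelsKerrDevDefs
import HarnessLib

/-!
# Route PhotonSphereChannels · crux `ChannelsResolveTameDevelopmentsR` (K2R) — basic API of the anchored
# Kerr window deviation `kerrDev` (line `kerr-isolation-dichotomy`, supports stub S1 `stub_silentHullExtraction`)

Elementary, sorry-free facts about the window-deviation functional of
`Theorems/PhotonSphereChannelsKerrDevDefs.lean` (`kerrWindow`, `IsWindowChart`, `anchoredDev`, `kerrDev`), used by every
stub of the line that manipulates `kerrDev` (S1's deviation dictionary, S5's band statement, S6's hypothesis):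

* monotonicity in the scale: `kerrWindow_mono`, `isWindowChart_of_le`, `anchoredDev_mono`, `kerrDev_mono`
  (a larger window is a stronger closeness requirement);
* the documented degeneracy at non-positive scales: `kerrWindow_eq_empty`, `anchoredDev_of_nonpos`,
  `kerrDev_of_nonpos` (`R ≤ 0 ⇒ kerrDev = 0`; the witness parameters are `M = a = 0`, whose "exterior" `{‖x⃗‖ > 0}` is
  inhabited by `(0, 1, 0, 0)`: `ofTimeSpace_single_mem_exterior_zero`);
* the unfolding of strict upper bounds: `anchoredDev_lt_iff`, `kerrDev_lt_iff` (`kerrDev < ε` iff SOME admissible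
  parameter pair, anchor and anchored window chart has window `C²`-deviation `< ε`);
* the order-theoretic shell of S1's one-sided deviation dictionary: `eventually_kerrDev_lt_of_forall_le`
  (if every level `δ` above `kerrDev 𝓢 p R` is eventually not exceeded along a sequence of pointed spacetimes, then every
  strict bound `kerrDev 𝓢 p R < ε` holds eventually along it) — the form in which the composition `isoWindow` consumes the
  dictionary; the geometric content (producing the charts along the sequence) is NOT here.

No new definitions. References: the functional is modelled on the `Cᵏ` closeness norms of Dafermos–Holzegel–Rodnianski–Taylor,
arXiv:2104.08222, §1 [arXiv210408222]; the infimum calculus is Mathlib's (`iInf_lt_iff`, `exists_between`).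
-/

noncomputable section

-- the operator-norm instance on `E4 →L[ℝ] E4 →L[ℝ] ℝ` needs one more level of pending
-- instance problems than the default (as in `PhotonSphereChannelsKerrDevDefs.lean`)
set_option maxSynthPendingDepth 3
-- every `Summit.FinalStateConjecture.FinalStateConjecture.…` name repeats the summit = sub-problem segment (D-0017 layout)
set_option linter.dupNamespace false

open Set Filter Function TopologicalSpace Manifold Bundle
open scoped Topology Manifold ContDiff ENNReal NNReal


namespace Summit.FinalStateConjecture.FinalStateConjecture.Theorems

open Literature.Geometry.Lorentzian
open Summit.FinalStateConjecture.FinalStateConjecture.Theorems.TameHull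

/-! ### Monotonicity in the scale -/

/-- Kerr windows grow with the scale: `B_R(x₀) ∩ {r > r₊} ⊆ B_{R'}(x₀) ∩ {r > r₊}` for `R ≤ R'`. [folklore] -/
theorem kerrWindow_mono : ∀ (M a : ℝ) (x₀ : Kerr.exterior M a) {R R' : ℝ}, R ≤ R' → kerrWindow M a x₀ R ⊆ kerrWindow M a x₀ R' :=
  fun _ _ _ _ _ h _ hx ↦ lt_of_lt_of_le hx h

/-- An anchored window chart at scale `R'` is an anchored window chart at every smaller scale `R ≤ R'` (all four
clauses restrict to the smaller window). [folklore] -/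
theorem isWindowChart_of_le : ∀ {𝓢 : Spacetime.{0} 4} {M a : ℝ} {x₀ : Kerr.exterior M a} {R R' : ℝ} {q : 𝓢.carrier} {Ψ : Kerr.exterior M a → 𝓢.carrier}, R ≤ R' → IsWindowChart 𝓢 M a x₀ R' q Ψ → IsWindowChart 𝓢 M a x₀ R q Ψ := by
  intro 𝓢 M a x₀ R R' q Ψ h hΨ
  exact ⟨hΨ.anchor, hΨ.contMDiffOn.mono (kerrWindow_mono M a x₀ h), hΨ.injOn.mono (kerrWindow_mono M a x₀ h),
    fun x hx hr ↦ hΨ.future x (kerrWindow_mono M a x₀ h hx) hr⟩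

/-- The anchored deviation at fixed parameters is monotone in the scale: every chart admissible at scale `R'` is
admissible at scale `R ≤ R'`, with a smaller window to take the supremum over. [folklore] -/
theorem anchoredDev_mono : ∀ {𝓢 : Spacetime.{0} 4} (q : 𝓢.carrier) (M a : ℝ) {R R' : ℝ}, R ≤ R' → anchoredDev 𝓢 q M a R ≤ anchoredDev 𝓢 q M a R' := by
  intro 𝓢 q M a R R' h
  refine le_iInf fun x₀ ↦ le_iInf fun Ψ ↦ le_iInf fun hΨ ↦ ?_
  exact (iInf_le_of_le x₀ <| iInf_le_of_le Ψ <| iInf_le _ (isWindowChart_of_le h hΨ)).trans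
    (supCkENorm_mono (image_mono (kerrWindow_mono M a x₀ h)) _ _)

/-- **`kerrDev 𝓢 q ·` is monotone in the scale** (closeness on a larger window is a stronger requirement). [folklore] -/
theorem kerrDev_mono : ∀ {𝓢 : Spacetime.{0} 4} (q : 𝓢.carrier) {R R' : ℝ}, R ≤ R' → kerrDev 𝓢 q R ≤ kerrDev 𝓢 q R' := by
  intro 𝓢 q R R' h
  exact iInf_mono fun M ↦ iInf_mono fun a ↦ iInf_mono fun _ ↦ anchoredDev_mono q M a h

/-! ### Non-positive scales: the documented degeneracy `kerrDev = 0` -/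

/-- At a non-positive scale the Kerr window is empty. [folklore] -/
theorem kerrWindow_eq_empty : ∀ (M a : ℝ) (x₀ : Kerr.exterior M a) {R : ℝ}, R ≤ 0 → kerrWindow M a x₀ R = ∅ :=
  fun _ _ _ _ h ↦ eq_empty_of_forall_notMem fun _ hx ↦ (dist_nonneg.trans_lt hx).not_ge h

/-- The point `(0, 1, 0, 0)` lies in the "exterior" `{‖x⃗‖ > 0}` of the parameters `M = a = 0` (the punctured flat
model allowed by `kerrDev`): `Kerr.exterior 0 0` is inhabited. [folklore] -/
theorem ofTimeSpace_single_mem_exterior_zero : E4.ofTimeSpace 0 (EuclideanSpace.single 0 1) ∈ Kerr.exterior 0 0 := by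
  rw [Kerr.mem_exterior, Kerr.rPlus_zero_right le_rfl, Kerr.radius_zero_left, E4.spatialNorm_ofTimeSpace, mul_zero,
    max_self]
  simp

/-- At a non-positive scale the anchored deviation vanishes as soon as the exterior `{r > r₊}` of the parameters is
inhabited: the constant map to `q` is an anchored window chart on the empty window, whose deviation has `C²` sup norm
`0` over the empty set. [folklore] -/
theorem anchoredDev_of_nonpos : ∀ {𝓢 : Spacetime.{0} 4} (q : 𝓢.carrier) {M a R : ℝ} (x₀ : Kerr.exterior M a), R ≤ 0 → anchoredDev 𝓢 q M a R = 0 := by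
  intro 𝓢 q M a R x₀ h
  refine nonpos_iff_eq_zero.mp ?_
  have hW : kerrWindow M a x₀ R = ∅ := kerrWindow_eq_empty M a x₀ h
  have hΨ : IsWindowChart 𝓢 M a x₀ R q (fun _ ↦ q) :=
    ⟨rfl, by rw [hW]; exact contMDiffOn_const, by rw [hW]; exact injOn_empty _,
      fun x hx _ ↦ by rw [hW] at hx; exact hx.elim⟩
  have h1 : anchoredDev 𝓢 q M a R ≤
      supCkENorm (Subtype.val '' kerrWindow M a x₀ R) 2 (𝓢.deviationExtend (Kerr.background M a) fun _ ↦ q) :=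
    iInf_le_of_le x₀ <| iInf_le_of_le (fun _ : Kerr.exterior M a ↦ q) <| iInf_le _ hΨ
  refine h1.trans (le_of_eq ?_)
  rw [hW, image_empty]
  simp [supCkENorm]

/-- **`kerrDev 𝓢 q R = 0` for `R ≤ 0`** (the documented harmless degeneracy of the functional: the flat parameters
`M = a = 0` are admissible and their window is empty). [folklore] -/
theorem kerrDev_of_nonpos : ∀ {𝓢 : Spacetime.{0} 4} (q : 𝓢.carrier) {R : ℝ}, R ≤ 0 → kerrDev 𝓢 q R = 0 := by
  intro 𝓢 q R h
  have h0 : anchoredDev 𝓢 q 0 0 R = 0 :=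
    anchoredDev_of_nonpos q (M := 0) (a := 0) ⟨_, ofTimeSpace_single_mem_exterior_zero⟩ h
  have h1 : kerrDev 𝓢 q R ≤ anchoredDev 𝓢 q 0 0 R :=
    iInf_le_of_le 0 <| iInf_le_of_le 0 <| iInf_le _ (show (0 : ℝ) ≤ 0 ∧ |(0 : ℝ)| ≤ 0 from ⟨le_rfl, by rw [abs_zero]⟩)
  exact nonpos_iff_eq_zero.mp (h1.trans_eq h0)

/-! ### Unfolding strict upper bounds -/

/-- `anchoredDev 𝓢 q M a R < ε` iff some anchor and some anchored window chart at `q` have window `C²`-deviation `< ε`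
(`iInf_lt_iff`, three times). [folklore] -/
theorem anchoredDev_lt_iff : ∀ {𝓢 : Spacetime.{0} 4} (q : 𝓢.carrier) (M a R : ℝ) (ε : ℝ≥0∞), anchoredDev 𝓢 q M a R < ε ↔ ∃ (x₀ : Kerr.exterior M a) (Ψ : Kerr.exterior M a → 𝓢.carrier), IsWindowChart 𝓢 M a x₀ R q Ψ ∧ supCkENorm (Subtype.val '' kerrWindow M a x₀ R) 2 (𝓢.deviationExtend (Kerr.background M a) Ψ) < ε := by
  intro 𝓢 q M a R ε
  simp only [anchoredDev, iInf_lt_iff, exists_prop]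

/-- `kerrDev 𝓢 q R < ε` iff some admissible parameter pair `0 ≤ M`, `|a| ≤ M`, some anchor and some anchored window
chart at `q` have window `C²`-deviation `< ε`. [folklore] -/
theorem kerrDev_lt_iff : ∀ {𝓢 : Spacetime.{0} 4} (q : 𝓢.carrier) (R : ℝ) (ε : ℝ≥0∞), kerrDev 𝓢 q R < ε ↔ ∃ (M a : ℝ) (x₀ : Kerr.exterior M a) (Ψ : Kerr.exterior M a → 𝓢.carrier), 0 ≤ M ∧ |a| ≤ M ∧ IsWindowChart 𝓢 M a x₀ R q Ψ ∧ supCkENorm (Subtype.val '' kerrWindow M a x₀ R) 2 (𝓢.deviationExtend (Kerr.background M a) Ψ) < ε := by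
  intro 𝓢 q R ε
  simp only [kerrDev, iInf_lt_iff, anchoredDev_lt_iff, exists_prop]
  constructor
  · rintro ⟨M, a, ⟨hM, ha⟩, x₀, Ψ, hΨ, hlt⟩
    exact ⟨M, a, x₀, Ψ, hM, ha, hΨ, hlt⟩
  · rintro ⟨M, a, x₀, Ψ, hM, ha, hΨ, hlt⟩
    exact ⟨M, a, ⟨hM, ha⟩, x₀, Ψ, hΨ, hlt⟩

/-- A strict bound on `kerrDev` is witnessed by ONE admissible anchored window chart (the direction of `kerrDev_lt_iff`
used to bound the functional along a sequence). [folklore] -/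
theorem kerrDev_lt_of_isWindowChart : ∀ {𝓢 : Spacetime.{0} 4} {q : 𝓢.carrier} {M a R : ℝ} {x₀ : Kerr.exterior M a} {Ψ : Kerr.exterior M a → 𝓢.carrier} {ε : ℝ≥0∞}, 0 ≤ M → |a| ≤ M → IsWindowChart 𝓢 M a x₀ R q Ψ → supCkENorm (Subtype.val '' kerrWindow M a x₀ R) 2 (𝓢.deviationExtend (Kerr.background M a) Ψ) < ε → kerrDev 𝓢 q R < ε :=
  fun hM ha hΨ hlt ↦ (kerrDev_lt_iff _ _ _).2 ⟨_, _, _, _, hM, ha, hΨ, hlt⟩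

/-! ### The order-theoretic shell of the one-sided deviation dictionary -/

/-- **Shell of S1's deviation dictionary.** Let `(𝓣 n, q n)` be pointed spacetimes (e.g. `(𝒟, q (φ n))` along an
extraction) and `(𝓢, p)` a pointed spacetime (the hull element). If for every level `δ` STRICTLY above `kerrDev 𝓢 p R`
the deviations `kerrDev (𝓣 n) (q n) R` are eventually `≤ δ` (this is what pushing ONE near-optimal anchored window chart
of the limit through comparison maps delivers), then every strict bound `kerrDev 𝓢 p R < ε` holds eventually along the
sequence — the clause of `stub_silentHullExtraction` consumed by `isoWindow`. Pure order theory (`exists_between` in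
`ℝ≥0∞`); any filter. [folklore] -/
theorem eventually_kerrDev_lt_of_forall_le : ∀ {ι : Type} {l : Filter ι} {𝓣 : ι → Spacetime.{0} 4} {q : ∀ n, (𝓣 n).carrier} {𝓢 : Spacetime.{0} 4} {p : 𝓢.carrier} {R : ℝ}, (∀ δ : ℝ≥0∞, kerrDev 𝓢 p R < δ → ∀ᶠ n in l, kerrDev (𝓣 n) (q n) R ≤ δ) → ∀ ε : ℝ≥0∞, kerrDev 𝓢 p R < ε → ∀ᶠ n in l, kerrDev (𝓣 n) (q n) R < ε := by
  intro ι l 𝓣 q 𝓢 p R h ε hε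
  obtain ⟨δ, hδ, hδε⟩ := exists_between hε
  exact (h δ hδ).mono fun n hn ↦ hn.trans_lt hδε

end Summit.FinalStateConjecture.FinalStateConjecture.Theorems

end
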